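/-
Copyright (c) 2026 the pub-hodgecm-mathlib formalisation cell (harness21).  Prover seat hodgecm-mathlib-F0P3a-p03 (g21), 2026-09-02 (LH7 leaf ED. 3 road, (O8b♭) local,
«DET-SCALAR» road: the norm-one-determinant part of the quasi-split `U(1,1)` is generated by unitary transvections, each inside a compact subgroup).
-/
import Literature.NumberTheory.LocalFields.GLnCompactSubgroupsGenerate        -- ★ p850404: `exists_isCompact_isOpen_subgroup_transvection_mem`
import Literature.NumberTheory.Automorphic.UnitaryGroupOfFormAdelicTopology   -- ★ `unitaryGroupOfForm`, `mem_unitaryGroupOfForm_iff`, `isClosed_unitaryGroupOfForm`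
import HarnessLib

/-!
# `SU(1,1)`: the determinant-one elements of `U(σ, antidiag(1,1))` over a field with an endomorphism `σ` are words in unitary transvections; over a non-archimedean local field
# each such word lies in the subgroup generated by the compact subgroups of `U(σ, antidiag(1,1))`

Topic `NumberTheory/Automorphic`; namespace `Literature.NumberTheory.Automorphic.UnitaryOneOne`.  THEOREMS ONLY: no definition, no named fact, no instance, no notation, no `sorry`.
Companion of ★ `Literature.GroupTheory.DicksonGL2` (`exists_word_of_det_eq_one`: «the transvections generate `SL₂`») for the quasi-split unitary group in two variables.

THE MATHEMATICS.  Let `R` be a field, `σ : R →+* R` a ring endomorphism and `J = antidiag(1,1) = !![0, 1; 1, 0]`; `U := U(σ, J) = {g ∈ GL₂(R) | ᵗ(σ g) J g = J}` (★ `unitaryGroupOfForm`).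
For `g = [[a, b], [c, d]] ∈ U` with `det g = 1` one has `g⁻¹ = adj g = [[d, −b], [−c, a]]` and `J ᵗ(σg) J = [[σd, σb], [σc, σa]]`, so the unitarity relation `J ᵗ(σ g) J = g⁻¹` reads
  `σ a = a`, `σ d = d`, `σ b = −b`, `σ c = −c`                                                            (§1 `entries_of_mem_of_det_eq_one`)
(for `R = E_w ⊃ F_v` the local quadratic extension at a non-split place: `SU(1,1)(F_v) = {[[a,b],[c,d]] | a, d ∈ F_v, b, c ∈ E_w^{σ = −1}, ad − bc = 1} ≅ SL₂(F_v)`).  The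
transvections `U(x) = [[1, x], [0, 1]]`, `L(y) = [[1, 0], [y, 1]]` lie in `U` iff `σ x = −x`, `σ y = −y` (§1 `units_transvectionStruct_mem_of_map_eq_neg`).  DICKSON'S WORD with
anti-fixed letters (§2): if `c ≠ 0`, `g = U((a−1)/c) · L(c) · U((d−1)/c)` and the three letters are `σ`-anti-fixed (fixed ∕ anti-fixed = anti-fixed); if `c = 0` then `a ≠ 0` and, for any
`θ ≠ 0` with `σ θ = −θ`, `L(θ) g` has lower-left entry `θ a ≠ 0`, so `g = L(−θ) · U(·) · L(·) · U(·)` — «`SU(1,1)` is generated by its unitary transvections»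
(`exists_word_of_mem_of_det_eq_one`).  TOPOLOGY (§3, `R` a non-archimedean local field, `σ` continuous): every transvection of `GL₂(R)` lies in a compact open subgroup `K ≤ GL₂(R)`
(★ p850404 `exists_isCompact_isOpen_subgroup_transvection_mem`), `U` is closed (★ `isClosed_unitaryGroupOfForm`), so `K ∩ U` is a compact subgroup of `U` containing the letter; hence
every `g ∈ U` with `det g = 1` lies in `U° := ⟨K′ ≤ U | K′ ⊆ compact⟩` (`mem_closure_isCompact_of_det_eq_one`) — the (SU-GEN) input of the (O8b♭) local isotypy at a non-split place,
written EXACTLY in the `Subgroup.closure (⋃ K ∈ {K | IsCompact ↑K}, ↑K)` currency of ★ `IrrClass.apply_eq_smul_of_forall_isConstituentOf_eq_of_mem_closure`.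
CONSUMER (cell `hodgecm-mathlib`, crux H413, line LH7): `Summits/…/Theorems/F0P3cPKtupleU2LocalIsotypy` (binder `hSU`) via ★ `localPiNonsplitEquiv`.
HONEST LABEL: elementary ([Dickson1901] Ch. XII; [Serre1972] §2.4; [PlatonovRapinchuk1994] §3.3, §6.2); HC_CM is proved only modulo the printed citations of that programme until its rung 0
closes; this file proves no printed citation of it.

## References
* [Dickson1901] L. E. Dickson, *Linear Groups* (1901), Ch. XII (generation of `SL₂` by transvections).
* [Serre1972] J.-P. Serre, Invent. Math. 15 (1972), §2.4 (proof of Prop. 15).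
* [PlatonovRapinchuk1994] V. Platonov, A. Rapinchuk, *Algebraic Groups and Number Theory* (1994), §3.3 (compact open subgroups of `p`-adic groups), §6.2, §7.1 (`SU(1,1) ≅ SL₂`).
* [Rogawski1990] J. D. Rogawski, *Automorphic Representations of Unitary Groups in Three Variables* (1990), §1.9 (quasi-split `U(1,1)`), §13.3 p. 203.
-/

set_option autoImplicit false

noncomputable section

open Matrix

namespace Literature.NumberTheory.Automorphic

namespace UnitaryOneOne

universe u

section Algebra

variable {R : Type u} [Field R] (σ : R →+* R)

/-! ## §1 Entries of `SU(σ, antidiag(1,1))` and the unitary transvections -/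

/-- `ᵗ(σ [[a,b],[c,d]]) = [[σa, σc],[σb, σd]]` (plumbing). [folklore] -/
private theorem transpose_map_fin_two (a b c d : R) :
    ((!![a, b; c, d]).map σ)ᵀ = !![σ a, σ c; σ b, σ d] := by
  ext i j
  fin_cases i <;> fin_cases j <;> rfl

/-- The upper unitary transvection `U(x) = T₀₁(x)` as an explicit matrix (plumbing). [folklore] -/
private theorem transvection_zero_one_eq (x : R) : transvection (0 : Fin 2) 1 x = !![1, x; 0, 1] := by
  ext i j
  fin_cases i <;> fin_cases j <;> simp [transvection, Matrix.single]

/-- The lower unitary transvection `L(y) = T₁₀(y)` as an explicit matrix (plumbing). [folklore] -/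
private theorem transvection_one_zero_eq (y : R) : transvection (1 : Fin 2) 0 y = !![1, 0; y, 1] := by
  ext i j
  fin_cases i <;> fin_cases j <;> simp [transvection, Matrix.single]

/-- `U(r) · L(c) · U(s) = [[1 + r c, s + r (c s + 1)], [c, c s + 1]]` (plumbing). [folklore] -/
private theorem transvection_mul_mul_eq (r c s : R) :
    transvection (0 : Fin 2) 1 r * transvection (1 : Fin 2) 0 c * transvection (0 : Fin 2) 1 s =
      !![1 + r * c, s + r * (c * s + 1); c, c * s + 1] := by
  rw [transvection_zero_one_eq, transvection_zero_one_eq, transvection_one_zero_eq]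
  simp only [Matrix.mul_fin_two]
  congr 1
  ring

/-- **Entries of a determinant-one element of `U(σ, antidiag(1,1))`**: for `g = [[a,b],[c,d]] ∈ U(σ, J)`, `J = antidiag(1,1)`, with `det g = 1`: `σ a = a`, `σ b = −b`, `σ c = −c`,
`σ d = d` (the unitarity relation `J ᵗ(σg) J = g⁻¹ = adj g` read entrywise — «`SU(1,1)(F) = {a, d ∈ F; b, c ∈ E^{σ=−1}; ad − bc = 1}`»).
[cite: PlatonovRapinchuk1994, §7.1] [cite: Rogawski1990, §1.9] -/
theorem entries_of_mem_of_det_eq_one {J : Matrix (Fin 2) (Fin 2) R} (hJ : J = !![0, 1; 1, 0]) {g : GL (Fin 2) R} (hg : g ∈ unitaryGroupOfForm σ J)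
    (hdet : (g : Matrix (Fin 2) (Fin 2) R).det = 1) :
    σ ((g : Matrix (Fin 2) (Fin 2) R) 0 0) = (g : Matrix (Fin 2) (Fin 2) R) 0 0 ∧ σ ((g : Matrix (Fin 2) (Fin 2) R) 0 1) = -(g : Matrix (Fin 2) (Fin 2) R) 0 1 ∧
      σ ((g : Matrix (Fin 2) (Fin 2) R) 1 0) = -(g : Matrix (Fin 2) (Fin 2) R) 1 0 ∧ σ ((g : Matrix (Fin 2) (Fin 2) R) 1 1) = (g : Matrix (Fin 2) (Fin 2) R) 1 1 := by
  subst hJ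
  set a := (g : Matrix (Fin 2) (Fin 2) R) 0 0
  set b := (g : Matrix (Fin 2) (Fin 2) R) 0 1
  set c := (g : Matrix (Fin 2) (Fin 2) R) 1 0
  set d := (g : Matrix (Fin 2) (Fin 2) R) 1 1
  have hM : (g : Matrix (Fin 2) (Fin 2) R) = !![a, b; c, d] := Matrix.eta_fin_two _
  rw [mem_unitaryGroupOfForm_iff, hM, transpose_map_fin_two, Matrix.mul_fin_two, Matrix.mul_fin_two] at hg
  rw [hM, Matrix.det_fin_two_of] at hdet
  have h00 := congrArg (fun M : Matrix (Fin 2) (Fin 2) R => M 0 0) hg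
  have h01 := congrArg (fun M : Matrix (Fin 2) (Fin 2) R => M 0 1) hg
  have h10 := congrArg (fun M : Matrix (Fin 2) (Fin 2) R => M 1 0) hg
  have h11 := congrArg (fun M : Matrix (Fin 2) (Fin 2) R => M 1 1) hg
  simp only [of_apply, cons_val', cons_val_zero, cons_val_one, cons_val_fin_one, empty_val'] at h00 h01 h10 h11
  -- h00 : σa·0·a + … ; normalise the four relations
  have e1 : a * σ c + c * σ a = 0 := by linear_combination h00
  have e2 : b * σ c + d * σ a = 1 := by linear_combination h01
  have e3 : a * σ d + c * σ b = 1 := by linear_combination h10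
  have e4 : b * σ d + d * σ b = 0 := by linear_combination h11
  refine ⟨?_, ?_, ?_, ?_⟩
  · linear_combination a * e2 - b * e1 - σ a * hdet
  · linear_combination a * e4 - b * e3 - σ b * hdet
  · linear_combination d * e1 - c * e2 - σ c * hdet
  · linear_combination d * e3 - c * e4 - σ d * hdet

/-- **A transvection of `GL₂(R)` with `σ`-anti-fixed entry is unitary for `antidiag(1,1)`**: for `t = T_{ij}(x)` (`{i, j} = {0, 1}`) with `σ x = −x`, the unit `⟨t, t⁻¹⟩ ∈ U(σ, J)`
(`ᵗ(σ U(x)) J U(x) = [[0,1],[1, x + σx]]`, `ᵗ(σ L(y)) J L(y) = [[σy + y, 1],[1, 0]]`). [cite: PlatonovRapinchuk1994, §7.1] [cite: Rogawski1990, §1.9] -/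
theorem units_transvectionStruct_mem_of_map_eq_neg {J : Matrix (Fin 2) (Fin 2) R} (hJ : J = !![0, 1; 1, 0]) (t : TransvectionStruct (Fin 2) R) (ht : σ t.c = -t.c) :
    (⟨t.toMatrix, t.inv.toMatrix, t.mul_inv, t.inv_mul⟩ : GL (Fin 2) R) ∈ unitaryGroupOfForm σ J := by
  subst hJ
  obtain ⟨i, j, hij, x⟩ := t
  rw [mem_unitaryGroupOfForm_iff]
  change ((transvection i j x).map σ)ᵀ * !![0, 1; 1, 0] * transvection i j x = !![0, 1; 1, 0]
  change σ x = -x at ht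
  fin_cases i <;> fin_cases j
  · exact absurd rfl hij
  · simp only [Fin.zero_eta, Fin.mk_one]
    rw [transvection_zero_one_eq, transpose_map_fin_two, Matrix.mul_fin_two, Matrix.mul_fin_two, map_one, map_zero, ht]
    ext a b
    fin_cases a <;> fin_cases b <;> simp
  · simp only [Fin.mk_one, Fin.zero_eta]
    rw [transvection_one_zero_eq, transpose_map_fin_two, Matrix.mul_fin_two, Matrix.mul_fin_two, map_one, map_zero, ht]
    ext a b
    fin_cases a <;> fin_cases b <;> simp
  · exact absurd rfl hij

/-! ## §2 Dickson's word with anti-fixed letters: `SU(σ, antidiag(1,1))` is generated by its unitary transvections -/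

/-- quotient of a `σ`-fixed by a `σ`-anti-fixed element is anti-fixed (plumbing). [folklore] -/
private theorem map_div_eq_neg {p q : R} (hp : σ p = p) (hq : σ q = -q) : σ (p / q) = -(p / q) := by
  rw [map_div₀, hp, hq, div_neg]

/-- **Dickson's word, non-zero lower-left entry**: `g = [[a,b],[c,d]] ∈ U(σ, antidiag(1,1))`, `det g = 1`, `c ≠ 0` ⇒ `g = U((a−1)/c) · L(c) · U((d−1)/c)` with the three letters
`σ`-ANTI-FIXED (so unitary by `units_transvectionStruct_mem_of_map_eq_neg`). [cite: Dickson1901, Ch. XII] [cite: Serre1972, §2.4 (proof of Prop. 15)] [cite: PlatonovRapinchuk1994, §7.1] -/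
theorem eq_word_of_mem_of_det_eq_one_of_ne_zero {J : Matrix (Fin 2) (Fin 2) R} (hJ : J = !![0, 1; 1, 0]) {g : GL (Fin 2) R} (hg : g ∈ unitaryGroupOfForm σ J)
    (hdet : (g : Matrix (Fin 2) (Fin 2) R).det = 1) (h10 : (g : Matrix (Fin 2) (Fin 2) R) 1 0 ≠ 0) :
    σ (((g : Matrix (Fin 2) (Fin 2) R) 0 0 - 1) / (g : Matrix (Fin 2) (Fin 2) R) 1 0) = -(((g : Matrix (Fin 2) (Fin 2) R) 0 0 - 1) / (g : Matrix (Fin 2) (Fin 2) R) 1 0) ∧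
      σ ((g : Matrix (Fin 2) (Fin 2) R) 1 0) = -(g : Matrix (Fin 2) (Fin 2) R) 1 0 ∧
      σ (((g : Matrix (Fin 2) (Fin 2) R) 1 1 - 1) / (g : Matrix (Fin 2) (Fin 2) R) 1 0) = -(((g : Matrix (Fin 2) (Fin 2) R) 1 1 - 1) / (g : Matrix (Fin 2) (Fin 2) R) 1 0) ∧
      (g : Matrix (Fin 2) (Fin 2) R) =
        transvection (0 : Fin 2) 1 (((g : Matrix (Fin 2) (Fin 2) R) 0 0 - 1) / (g : Matrix (Fin 2) (Fin 2) R) 1 0) *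
          transvection (1 : Fin 2) 0 ((g : Matrix (Fin 2) (Fin 2) R) 1 0) *
          transvection (0 : Fin 2) 1 (((g : Matrix (Fin 2) (Fin 2) R) 1 1 - 1) / (g : Matrix (Fin 2) (Fin 2) R) 1 0) := by
  obtain ⟨ha, -, hc, hd⟩ := entries_of_mem_of_det_eq_one σ hJ hg hdet
  refine ⟨map_div_eq_neg σ (by rw [map_sub, map_one, ha]) hc, hc, map_div_eq_neg σ (by rw [map_sub, map_one, hd]) hc, ?_⟩
  rw [transvection_mul_mul_eq]
  rw [Matrix.det_fin_two] at hdet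
  ext i j
  fin_cases i <;> fin_cases j
  · simp only [Fin.zero_eta, Fin.isValue, of_apply, cons_val', cons_val_zero, cons_val_fin_one]
    field_simp
    ring
  · simp only [Fin.zero_eta, Fin.isValue, Fin.mk_one, of_apply, cons_val', cons_val_one, cons_val_fin_one, cons_val_zero]
    field_simp
    linear_combination -hdet
  · simp
  · simp only [Fin.mk_one, Fin.isValue, of_apply, cons_val', cons_val_one, cons_val_fin_one]
    field_simp
    ring

/-- **«`SU(1,1)` IS GENERATED BY ITS UNITARY TRANSVECTIONS».**  Let `g ∈ U(σ, antidiag(1,1))` with `det g = 1`, and let `θ ≠ 0` be `σ`-anti-fixed (exists as soon as `σ` is an involution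
`≠ id`, e.g. the conjugation of a quadratic extension).  Then `g = L(x₁) · U(x₂) · L(x₃) · U(x₄)` with all four letters `σ`-anti-fixed, i.e. unitary (`x₁ = 0` if `g₁₀ ≠ 0`; otherwise `x₁ = −θ`
and the rest is Dickson's word for `L(θ) g`, whose lower-left entry is `θ g₀₀ ≠ 0`). [cite: Dickson1901, Ch. XII] [cite: Serre1972, §2.4 (proof of Prop. 15)] [cite: PlatonovRapinchuk1994, §7.1] -/
theorem exists_word_of_mem_of_det_eq_one {J : Matrix (Fin 2) (Fin 2) R} (hJ : J = !![0, 1; 1, 0]) {g : GL (Fin 2) R} (hg : g ∈ unitaryGroupOfForm σ J)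
    (hdet : (g : Matrix (Fin 2) (Fin 2) R).det = 1) (θ : R) (hθ : σ θ = -θ) (hθ0 : θ ≠ 0) :
    ∃ x₁ x₂ x₃ x₄ : R, σ x₁ = -x₁ ∧ σ x₂ = -x₂ ∧ σ x₃ = -x₃ ∧ σ x₄ = -x₄ ∧
      (g : Matrix (Fin 2) (Fin 2) R) =
        transvection (1 : Fin 2) 0 x₁ * (transvection (0 : Fin 2) 1 x₂ * transvection (1 : Fin 2) 0 x₃ * transvection (0 : Fin 2) 1 x₄) := by
  by_cases h10 : (g : Matrix (Fin 2) (Fin 2) R) 1 0 ≠ 0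
  · obtain ⟨h₂, h₃, h₄, hw⟩ := eq_word_of_mem_of_det_eq_one_of_ne_zero σ hJ hg hdet h10
    exact ⟨0, _, _, _, by rw [map_zero, neg_zero], h₂, h₃, h₄, by rw [transvection_zero, Matrix.one_mul]; exact hw⟩
  · push Not at h10
    -- `N := L(θ) · g ∈ U`, `det N = 1`, `N₁₀ = θ g₀₀ ≠ 0`
    set L : GL (Fin 2) R := ⟨(⟨1, 0, by decide, θ⟩ : TransvectionStruct (Fin 2) R).toMatrix, (⟨1, 0, by decide, θ⟩ : TransvectionStruct (Fin 2) R).inv.toMatrix,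
      TransvectionStruct.mul_inv _, TransvectionStruct.inv_mul _⟩ with hL
    have hLval : ((L * g : GL (Fin 2) R) : Matrix (Fin 2) (Fin 2) R) = transvection (1 : Fin 2) 0 θ * (g : Matrix (Fin 2) (Fin 2) R) := rfl
    have hN : L * g ∈ unitaryGroupOfForm σ J := mul_mem (units_transvectionStruct_mem_of_map_eq_neg σ hJ _ hθ) hg
    have hNdet : ((L * g : GL (Fin 2) R) : Matrix (Fin 2) (Fin 2) R).det = 1 := by
      rw [hLval, Matrix.det_mul, det_transvection_of_ne _ _ (by decide), one_mul, hdet]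
    have h00 : (g : Matrix (Fin 2) (Fin 2) R) 0 0 ≠ 0 := by
      intro h0
      rw [Matrix.det_fin_two, h0, h10, zero_mul, mul_zero, sub_zero] at hdet
      exact zero_ne_one hdet
    have hN10 : ((L * g : GL (Fin 2) R) : Matrix (Fin 2) (Fin 2) R) 1 0 ≠ 0 := by
      rw [hLval, transvection_mul_apply_same, h10, zero_add]
      exact mul_ne_zero hθ0 h00
    obtain ⟨h₂, h₃, h₄, hw⟩ := eq_word_of_mem_of_det_eq_one_of_ne_zero σ hJ hN hNdet hN10
    refine ⟨-θ, _, _, _, by rw [map_neg, hθ, neg_neg], h₂, h₃, h₄, ?_⟩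
    -- `g = L(−θ) · (L(θ) g)`
    have hinv : transvection (1 : Fin 2) 0 (-θ) * transvection (1 : Fin 2) 0 θ = (1 : Matrix (Fin 2) (Fin 2) R) := by
      rw [transvection_mul_transvection_same _ _ (by decide), neg_add_cancel, transvection_zero]
    rw [← hw, hLval, ← Matrix.mul_assoc, hinv, Matrix.one_mul]

end Algebra

/-! ## §3 Over a non-archimedean local field: `SU(σ, antidiag(1,1)) ⊆ U°`, the subgroup generated by the compact subgroups of `U(σ, antidiag(1,1))` -/

section LocalField

variable {R : Type u} [Field R] [ValuativeRel R] [TopologicalSpace R] [IsNonarchimedeanLocalField R] [T2Space R] (σ : R →+* R)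

/-- **A unitary transvection lies in a compact subgroup of `U = U(σ, antidiag(1,1))`**: for `t = T_{ij}(x)` with `σ x = −x` there is `K′ ≤ U` with `IsCompact ↑K′` containing `⟨t, t⁻¹⟩` —
`K′ = K ∩ U` for a compact open `K ≤ GL₂(R)` containing the transvection (★ `exists_isCompact_isOpen_subgroup_transvection_mem`), `U` being closed (★ `isClosed_unitaryGroupOfForm`, `σ`
continuous). [cite: PlatonovRapinchuk1994, §3.3] -/
theorem exists_isCompact_subgroup_mem_of_map_eq_neg (hσ : Continuous σ) {J : Matrix (Fin 2) (Fin 2) R} (hJ : J = !![0, 1; 1, 0]) (t : TransvectionStruct (Fin 2) R)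
    (ht : σ t.c = -t.c) :
    ∃ K' : Subgroup ↥(unitaryGroupOfForm σ J), IsCompact (K' : Set ↥(unitaryGroupOfForm σ J)) ∧
      (⟨⟨t.toMatrix, t.inv.toMatrix, t.mul_inv, t.inv_mul⟩, units_transvectionStruct_mem_of_map_eq_neg σ hJ t ht⟩ : ↥(unitaryGroupOfForm σ J)) ∈ K' := by
  obtain ⟨K, hK, -, htK⟩ := Literature.NumberTheory.LocalFields.exists_isCompact_isOpen_subgroup_transvection_mem (F := R) t
  refine ⟨K.comap (unitaryGroupOfForm σ J).subtype, ?_, ?_⟩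
  · rw [Subgroup.coe_comap, Subgroup.coe_subtype]
    exact (isClosed_unitaryGroupOfForm hσ J).isClosedEmbedding_subtypeVal.isCompact_preimage hK
  · rw [Subgroup.mem_comap, Subgroup.coe_subtype]
    exact htK

/-- **`SU(σ, antidiag(1,1)) ⊆ U°`.**  Over a non-archimedean local field `R` with a continuous endomorphism `σ` admitting a non-zero anti-fixed element `θ`, every `g ∈ U = U(σ, antidiag(1,1))`
with `det g = 1` lies in the subgroup closure of `⋃ {K′ ≤ U | IsCompact ↑K′}` — the union written EXACTLY as in the `hg` binder of ★
`IrrClass.apply_eq_smul_of_forall_isConstituentOf_eq_of_mem_closure`.  (§2 word; each letter in a compact subgroup by `exists_isCompact_subgroup_mem_of_map_eq_neg`.)  The (SU-GEN) input of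
the (O8b♭) local isotypy at a NON-SPLIT place. [cite: PlatonovRapinchuk1994, §3.3; §7.1] [cite: Dickson1901, Ch. XII] [cite: Rogawski1990, §13.3 p. 203] -/
theorem mem_closure_isCompact_of_det_eq_one (hσ : Continuous σ) {J : Matrix (Fin 2) (Fin 2) R} (hJ : J = !![0, 1; 1, 0]) (θ : R) (hθ : σ θ = -θ) (hθ0 : θ ≠ 0)
    (g : ↥(unitaryGroupOfForm σ J)) (hdet : ((g : GL (Fin 2) R) : Matrix (Fin 2) (Fin 2) R).det = 1) :
    g ∈ Subgroup.closure (⋃ K ∈ {K : Subgroup ↥(unitaryGroupOfForm σ J) | IsCompact (K : Set ↥(unitaryGroupOfForm σ J))}, (K : Set ↥(unitaryGroupOfForm σ J))) := by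
  obtain ⟨x₁, x₂, x₃, x₄, h₁, h₂, h₃, h₄, hw⟩ := exists_word_of_mem_of_det_eq_one σ hJ g.2 hdet θ hθ hθ0
  -- the four letters as elements of `U`, each in a compact subgroup, hence in `U°`
  have hletter : ∀ (t : TransvectionStruct (Fin 2) R) (ht : σ t.c = -t.c),
      (⟨⟨t.toMatrix, t.inv.toMatrix, t.mul_inv, t.inv_mul⟩, units_transvectionStruct_mem_of_map_eq_neg σ hJ t ht⟩ : ↥(unitaryGroupOfForm σ J)) ∈
        Subgroup.closure (⋃ K ∈ {K : Subgroup ↥(unitaryGroupOfForm σ J) | IsCompact (K : Set ↥(unitaryGroupOfForm σ J))}, (K : Set ↥(unitaryGroupOfForm σ J))) := by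
    intro t ht
    obtain ⟨K', hK', htK'⟩ := exists_isCompact_subgroup_mem_of_map_eq_neg σ hσ hJ t ht
    exact Subgroup.subset_closure (Set.mem_iUnion₂.2 ⟨K', hK', htK'⟩)
  have hg : g = (⟨⟨TransvectionStruct.toMatrix ⟨1, 0, by decide, x₁⟩, TransvectionStruct.toMatrix (TransvectionStruct.inv ⟨1, 0, by decide, x₁⟩),
        TransvectionStruct.mul_inv _, TransvectionStruct.inv_mul _⟩, units_transvectionStruct_mem_of_map_eq_neg σ hJ ⟨1, 0, by decide, x₁⟩ h₁⟩ : ↥(unitaryGroupOfForm σ J)) *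
      ((⟨⟨TransvectionStruct.toMatrix ⟨0, 1, by decide, x₂⟩, TransvectionStruct.toMatrix (TransvectionStruct.inv ⟨0, 1, by decide, x₂⟩),
          TransvectionStruct.mul_inv _, TransvectionStruct.inv_mul _⟩, units_transvectionStruct_mem_of_map_eq_neg σ hJ ⟨0, 1, by decide, x₂⟩ h₂⟩ : ↥(unitaryGroupOfForm σ J)) *
        (⟨⟨TransvectionStruct.toMatrix ⟨1, 0, by decide, x₃⟩, TransvectionStruct.toMatrix (TransvectionStruct.inv ⟨1, 0, by decide, x₃⟩),
          TransvectionStruct.mul_inv _, TransvectionStruct.inv_mul _⟩, units_transvectionStruct_mem_of_map_eq_neg σ hJ ⟨1, 0, by decide, x₃⟩ h₃⟩ : ↥(unitaryGroupOfForm σ J)) *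
        (⟨⟨TransvectionStruct.toMatrix ⟨0, 1, by decide, x₄⟩, TransvectionStruct.toMatrix (TransvectionStruct.inv ⟨0, 1, by decide, x₄⟩),
          TransvectionStruct.mul_inv _, TransvectionStruct.inv_mul _⟩, units_transvectionStruct_mem_of_map_eq_neg σ hJ ⟨0, 1, by decide, x₄⟩ h₄⟩ : ↥(unitaryGroupOfForm σ J))) :=
    Subtype.ext (Units.ext (by
      rw [Subgroup.coe_mul, Subgroup.coe_mul, Subgroup.coe_mul, Units.val_mul, Units.val_mul, Units.val_mul]
      exact hw))
  rw [hg]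
  exact mul_mem (hletter _ h₁) (mul_mem (mul_mem (hletter _ h₂) (hletter _ h₃)) (hletter _ h₄))

end LocalField

end UnitaryOneOne

end Literature.NumberTheory.Automorphic

end
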